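import Literature.NumberTheory.Sieve.PolynomialCongruencesTypeIUniform
import Literature.NumberTheory.Sieve.IwaniecAlmostPrimesQuadratic
import Summits.Parity.BatemanHorn.Theorems.RoughValueTransportDefs
import HarnessLib

/-!
# Route `RoughValueTransport`, crux `BalancedSemiprimeLayer` (stmt-Parity-9469), line
# `smooth-modulus-twisted-hooley`: uniform Type-I information (`stub_uniformTypeI`)

For an irreducible quadratic `g = aX² + bX + c ∈ ℤ[X]` the lever `TwistedHooleyDilates Δ`
(`Δ = b² − 4ac`: a power saving for the root Weyl sums of the dilates `Q²X² − Δ` over the moduli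
`m ≤ M` of a class `m ≡ u (mod Q)`, `(m, Q) = 1`, with losses polynomial in `Q` and `h`) implies
`UniformTypeI g`: plain Type-I information for the congruence counts
`#{y < t ≤ 2y : t ≡ b₀ (q), n ∣ g(t)}` summed with cancellation over level-`ℓ` moduli
`n ≤ y^{1+θ}` prime to `q·|2aΔ|`, UNIFORMLY in the progression modulus `q ≤ y^θ`.

Proof.  The analytic work is the tree's PROVED `Literature/NumberTheory/Sieve/
PolynomialCongruencesTypeIUniform.lean`: (i) `TypeIUniform.weylLevelBound_uniform` turns the
(normalised) class bound into the level Weyl bound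
`|∑_{n ≤ x, L ∣ n, (n, q|2aΔ|)=1} S_{g(qX+b₁)}(h; n)| ≤ K_w q^{A_q} (1+|h|)^{C} L^{C} x^{1−δ₀}`
(twisted multiplicativity, completing the square, reciprocity, classes modulo `q|2aΔ|e`, Abel
summation; the level `L ∣ n` through the `L`-part `e = gcd(n, Lⁿ)`, Rankin for large `e`);
(ii) `TypeIUniform.typeI_of_weylLevelBound_uniform` is the argument of
`TypeIFromWeyl.typeI_of_weylLevelBound` (Hooley 1967 §3) with the constant tracked —
`9C_ρ + 1872·2^{C}·K_W`, linear in the Weyl constant `K_W = K_w q^{A_q}` — giving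
`|T| ≤ K q^{A_q} y^{1−ε}` for `y ≥ y₀`, `q ≤ y`, with `K, y₀` independent of `q`.  Here we
normalise the lever (`lever_normalise`: `0 < η ≤ 1/2`, `A ≥ 0`, `K ≥ 1`, all `M`), feed it in
(`disc g ≠ 0` by `Iwaniec1978.disc_ne_zero`), and absorb `q^{A_q} ≤ y^{θA_q} ≤ y^{ε/2}` with
`θ = ε/(2A_q + 2)`: `UniformTypeI g` holds with `(θ, ε₀) = (ε/(2A_q+2), ε/2)`.
-/

noncomputable section

open Polynomial Filter Finset
open Literature.NumberTheory.Sieve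

namespace Summit.Parity.BatemanHorn.Cruxes.BalancedSemiprimeLayer.SmoothModulusTwistedHooley

/-! ### The normalised lever -/

/-- **Normalising the lever**: from `TwistedHooleyDilates D` one gets exponents `0 < η ≤ 1/2`,
`A ≥ 0`, a constant `K ≥ 1`, and the bound for every `M ≥ 0`. [folklore] -/
private theorem lever_normalise {D : ℤ} (H : TwistedHooleyDilates D) :
    ∃ η A K : ℝ, 0 < η ∧ η ≤ 1 / 2 ∧ 0 ≤ A ∧ 1 ≤ K ∧
      ∀ (Q u : ℕ) (h : ℤ) (M : ℕ), 0 < Q → h ≠ 0 →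
        ‖∑ m ∈ (Icc 1 M).filter (fun m : ℕ => m ≡ u [MOD Q] ∧ m.Coprime Q),
            polyRootWeylSum (C ((Q : ℤ) ^ 2) * X ^ 2 - C D) m h‖ ≤
          K * (Q : ℝ) ^ A * |(h : ℝ)| ^ A * (M : ℝ) ^ (1 - η) := by
  obtain ⟨η, hη, A, K, hb⟩ := H
  refine ⟨min η (1 / 2), max A 0, max K 1, lt_min hη (by norm_num), min_le_right _ _,
    le_max_right _ _, le_max_right _ _, fun Q u h M hQ hh => ?_⟩
  have hQ1 : (1 : ℝ) ≤ Q := by exact_mod_cast hQ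
  have hh1 : (1 : ℝ) ≤ |(h : ℝ)| := by
    rw [← Int.cast_abs]; exact_mod_cast Int.one_le_abs hh
  have hK1 : (1 : ℝ) ≤ max K 1 := le_max_right _ _
  rcases Nat.lt_or_ge M 2 with hM | hM
  · -- `M ≤ 1`: trivial bound
    have htriv : ‖∑ m ∈ (Icc 1 M).filter (fun m : ℕ => m ≡ u [MOD Q] ∧ m.Coprime Q),
        polyRootWeylSum (C ((Q : ℤ) ^ 2) * X ^ 2 - C D) m h‖ ≤ (M : ℝ) ^ (1 - min η (1 / 2)) := by
      interval_cases M
      · simp only [Nat.cast_zero]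
        rw [show Icc 1 0 = (∅ : Finset ℕ) by rfl, Finset.filter_empty, Finset.sum_empty, norm_zero]
        exact Real.rpow_nonneg le_rfl _
      · refine (norm_sum_le _ _).trans ?_
        calc ∑ m ∈ (Icc 1 1).filter (fun m : ℕ => m ≡ u [MOD Q] ∧ m.Coprime Q),
              ‖polyRootWeylSum (C ((Q : ℤ) ^ 2) * X ^ 2 - C D) m h‖
            ≤ ∑ m ∈ Icc 1 1, ‖polyRootWeylSum (C ((Q : ℤ) ^ 2) * X ^ 2 - C D) m h‖ :=
              Finset.sum_le_sum_of_subset_of_nonneg (Finset.filter_subset _ _)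
                fun _ _ _ => norm_nonneg _
          _ ≤ 1 := by
              rw [Finset.Icc_self, Finset.sum_singleton]
              refine (norm_polyRootWeylSum_le _ _ _).trans ?_
              rw [polyRootCountMod_one]; simp
          _ = ((1 : ℕ) : ℝ) ^ (1 - min η (1 / 2)) := by simp
    refine htriv.trans ?_
    have h1 : (1 : ℝ) ≤ max K 1 * (Q : ℝ) ^ max A 0 * |(h : ℝ)| ^ max A 0 := by
      have h2 : (1 : ℝ) ≤ (Q : ℝ) ^ max A 0 := Real.one_le_rpow hQ1 (le_max_right _ _)
      have h3 : (1 : ℝ) ≤ |(h : ℝ)| ^ max A 0 := Real.one_le_rpow hh1 (le_max_right _ _)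
      calc (1 : ℝ) = 1 * 1 * 1 := by ring
        _ ≤ _ := mul_le_mul (mul_le_mul hK1 h2 zero_le_one (by linarith)) h3 zero_le_one
          (by positivity)
    calc (M : ℝ) ^ (1 - min η (1 / 2)) = 1 * (M : ℝ) ^ (1 - min η (1 / 2)) := (one_mul _).symm
      _ ≤ _ := mul_le_mul_of_nonneg_right h1 (by positivity)
  · refine (hb Q u h M hQ hh hM).trans ?_
    have hM1 : (1 : ℝ) ≤ M := by exact_mod_cast (show 1 ≤ M by omega)
    have hX0 : 0 ≤ (Q : ℝ) ^ A * |(h : ℝ)| ^ A * (M : ℝ) ^ (1 - η) := by positivity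
    have hXX : (Q : ℝ) ^ A * |(h : ℝ)| ^ A * (M : ℝ) ^ (1 - η) ≤
        (Q : ℝ) ^ max A 0 * |(h : ℝ)| ^ max A 0 * (M : ℝ) ^ (1 - min η (1 / 2)) := by
      refine mul_le_mul (mul_le_mul ?_ ?_ (by positivity) (by positivity)) ?_ (by positivity)
        (by positivity)
      · exact Real.rpow_le_rpow_of_exponent_le hQ1 (le_max_left _ _)
      · exact Real.rpow_le_rpow_of_exponent_le hh1 (le_max_left _ _)
      · exact Real.rpow_le_rpow_of_exponent_le hM1 (by linarith [min_le_left η (1 / 2)])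
    calc K * (Q : ℝ) ^ A * |(h : ℝ)| ^ A * (M : ℝ) ^ (1 - η)
        = K * ((Q : ℝ) ^ A * |(h : ℝ)| ^ A * (M : ℝ) ^ (1 - η)) := by ring
      _ ≤ max K 1 * ((Q : ℝ) ^ A * |(h : ℝ)| ^ A * (M : ℝ) ^ (1 - η)) :=
          mul_le_mul_of_nonneg_right (le_max_left _ _) hX0
      _ ≤ max K 1 * ((Q : ℝ) ^ max A 0 * |(h : ℝ)| ^ max A 0 * (M : ℝ) ^ (1 - min η (1 / 2))) :=
          mul_le_mul_of_nonneg_left hXX (by positivity)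
      _ = _ := by ring

/-! ### The stub -/

/-- **stub_uniformTypeI** (line `smooth-modulus-twisted-hooley`, crux `stmt-Parity-9469`).  For an
irreducible quadratic `g = aX² + bX + c ∈ ℤ[X]`, the lever `TwistedHooleyDilates (b² − 4ac)`
implies uniform plain Type-I information `UniformTypeI g`: the level Weyl bound
`TypeIUniform.weylLevelBound_uniform` (constant `K_w q^{A_q}`) fed into the uniform form
`TypeIUniform.typeI_of_weylLevelBound_uniform` of the tree's Type-I theorem gives
`|T| ≤ K q^{A_q} y^{1−ε}`, and `q ≤ y^θ` with `θ = ε/(2A_q + 2)` gives `K y^{1−ε/2}`. [folklore] -/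
theorem stub_uniformTypeI :
    ∀ g : ℤ[X], g.natDegree = 2 → Irreducible g →
      TwistedHooleyDilates (discrim (g.coeff 2) (g.coeff 1) (g.coeff 0)) → UniformTypeI g := by
  intro g hdeg hirr HT
  -- `g = aX² + bX + c₀`
  have hg : g = C (g.coeff 2) * X ^ 2 + C (g.coeff 1) * X + C (g.coeff 0) := by
    conv_lhs => rw [g.as_sum_range_C_mul_X_pow, hdeg]
    simp only [Finset.sum_range_succ, Finset.sum_range_zero, zero_add, pow_zero, mul_one, pow_one]
    ring
  have hg0 : g ≠ 0 := hirr.ne_zero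
  have ha : g.coeff 2 ≠ 0 := by
    have h := leadingCoeff_ne_zero.mpr hg0
    rwa [Polynomial.leadingCoeff, hdeg] at h
  have hirr' : Irreducible (C (g.coeff 2) * X ^ 2 + C (g.coeff 1) * X + C (g.coeff 0)) := hg ▸ hirr
  have hΔ : discrim (g.coeff 2) (g.coeff 1) (g.coeff 0) ≠ 0 := by
    unfold discrim; exact Iwaniec1978.disc_ne_zero ha hirr'
  obtain ⟨η, A, K, hη0, hη2, hA0, hK1, HB⟩ := lever_normalise HT
  obtain ⟨Kw, Aq, Cw, δ₀, hKw, hAq, hCw, hδ0, hδ1, HWL⟩ :=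
    TypeIUniform.weylLevelBound_uniform ha hirr' hΔ hη0 hη2 hA0 hK1 HB
  rw [← hg] at HWL
  -- the data of the uniform Type-I theorem
  have hdegpos : 0 < g.natDegree := by rw [hdeg]; norm_num
  have hprim : g.IsPrimitive := hirr.isPrimitive (by rw [hdeg]; decide)
  have hirrQ : Irreducible (g.map (Int.castRingHom ℚ)) := by
    rw [← algebraMap_int_eq]
    exact (hprim.irreducible_iff_irreducible_map_fraction_map (K := ℚ)).mp hirr
  have hcB : ∀ p : ℕ, p.Prime → (p : ℤ) ∣ g.content →
      p ∣ (2 * g.coeff 2 * discrim (g.coeff 2) (g.coeff 1) (g.coeff 0)).natAbs := by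
    intro p hp hpc
    rw [hprim.content_eq_one] at hpc
    have := Int.eq_one_of_dvd_one (by positivity) hpc
    exact absurd (by exact_mod_cast this) hp.ne_one
  set ε : ℝ := δ₀ / (20 + 6 * Cw) with hεdef
  have hε : 0 < ε := by rw [hεdef]; positivity
  have hεδ : ε * (20 + 6 * Cw) ≤ δ₀ := by rw [hεdef, div_mul_cancel₀ _ (by positivity)]
  have hε1 : ε ≤ 1 / 20 := by
    rw [hεdef, div_le_div_iff₀ (by positivity) (by norm_num)]; nlinarith
  obtain ⟨K, y₀, hK⟩ := TypeIUniform.typeI_of_weylLevelBound_uniform g hirrQ hdegpos hcB hδ1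
    hCw hKw hAq.le HWL hε hεδ
  -- the exponents
  set θ : ℝ := ε / (2 * Aq + 2) with hθdef
  have hθ0 : 0 < θ := by rw [hθdef]; positivity
  have hθε : θ ≤ ε / 2 := by
    rw [hθdef, div_le_div_iff₀ (by positivity) (by norm_num)]; nlinarith
  have hθA : θ * Aq ≤ ε / 2 := by
    rw [hθdef, div_mul_eq_mul_div, div_le_div_iff₀ (by positivity) (by norm_num)]; nlinarith
  refine ⟨θ, ε / 2, max K 1, hθ0, by positivity, max y₀ 1,
    fun y hy q b₀ hq hqy ℓ N₁ N₂ hℓ hℓy hN12 hN₂ => ?_⟩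
  have hy1n : 1 ≤ y := le_trans (le_max_right _ _) hy
  have hy1 : (1 : ℝ) ≤ y := by exact_mod_cast hy1n
  have hy0 : (0 : ℝ) < y := by linarith
  have hrle : ∀ {u v : ℝ}, u ≤ v → (y : ℝ) ^ u ≤ (y : ℝ) ^ v := fun h =>
    Real.rpow_le_rpow_of_exponent_le hy1 h
  -- the ranges of the uniform theorem
  have hqy' : q ≤ y := by
    have : (q : ℝ) ≤ y := hqy.trans (by simpa using hrle (show θ ≤ 1 by linarith))
    exact_mod_cast this
  have hℓy' : (ℓ : ℝ) ≤ (y : ℝ) ^ ε := hℓy.trans (hrle (by linarith))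
  have hN₂' : (N₂ : ℝ) ≤ (y : ℝ) ^ (1 + ε) := hN₂.trans (hrle (by linarith))
  have hT := hK y (le_trans (le_max_left _ _) hy) q b₀ hq hqy' ℓ N₁ N₂ hℓ hℓy' hN12 hN₂'
  refine hT.trans ?_
  -- `K q^{A_q} y^{1-ε} ≤ max K 1 · y^{1-ε/2}`
  have hq0 : (0 : ℝ) ≤ q := Nat.cast_nonneg _
  have hqA : (q : ℝ) ^ Aq ≤ (y : ℝ) ^ (ε / 2) :=
    calc (q : ℝ) ^ Aq ≤ ((y : ℝ) ^ θ) ^ Aq := Real.rpow_le_rpow hq0 hqy hAq.le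
      _ = (y : ℝ) ^ (θ * Aq) := by rw [← Real.rpow_mul hy0.le]
      _ ≤ (y : ℝ) ^ (ε / 2) := hrle hθA
  have hpos : 0 ≤ (q : ℝ) ^ Aq * (y : ℝ) ^ (1 - ε) := by positivity
  calc K * (q : ℝ) ^ Aq * (y : ℝ) ^ (1 - ε) = K * ((q : ℝ) ^ Aq * (y : ℝ) ^ (1 - ε)) := by ring
    _ ≤ max K 1 * ((q : ℝ) ^ Aq * (y : ℝ) ^ (1 - ε)) :=
        mul_le_mul_of_nonneg_right (le_max_left _ _) hpos
    _ ≤ max K 1 * ((y : ℝ) ^ (ε / 2) * (y : ℝ) ^ (1 - ε)) := by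
        refine mul_le_mul_of_nonneg_left (mul_le_mul_of_nonneg_right hqA (by positivity)) ?_
        exact le_trans zero_le_one (le_max_right _ _)
    _ = max K 1 * (y : ℝ) ^ (1 - ε / 2) := by
        rw [← Real.rpow_add hy0]; congr 2; ring

end Summit.Parity.BatemanHorn.Cruxes.BalancedSemiprimeLayer.SmoothModulusTwistedHooley
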